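import Summits.CriticalPhenomena.PercolationContinuityZ3.Theorems.PercNearOneGluingNoHeavyQuantBlockCombLightMerge
import HarnessLib

/-!
# QUANT lane R8, FAR on trees: RAISING THE FIRST CHAIN GATE (the contraction principle without a root-mass hypothesis) and the
# block-star row read at the root of any chain (canonical block-comb model)

builds on p205010 (kernel theorem, internal audit signed; external expert review pending)

Support file (`--supports stmt-CriticalPhenomena-4575`), QUANT lane seat prim-quant-p1 (gen 9); memo
`run/shared/lean/prim/quant/P1-SURPLUS.md` §20.  Theorems only (local notation, no definitions), no sorries, standard axioms.
Model and notation: `…QuantBlockCombMergeModel.lean` (chain gates `q`, levels `lv`, sizes `a`, private gates `g`, explicit tail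
`TAIL = P(N ≥ j+1)`; marginal of blob `k` = `(∏_{i<lv k} q i)·g k`); tools: `tail_update_dead` (`…QuantBlockCombLightMerge.lean`, same
seat), `tail_one_ge_rootGate_of_mean` (lead g13), `prefixProd_update_succ` / `prefixProd_succ` (lead g13).  Used by the HALF-CLASS theorem
(`…QuantBlockCombHalfClass.lean`, same seat).

* `Quant.BlockComb.tail_succ_eq_rootSplit` — the ROOT SPLIT as an identity: `TAIL[D+1, q] = (1 − q 0)·C₀ + q 0·TAIL[D, q∘succ, lv − 1]`
  with `C₀ = P(the root blobs alone cross)` (the lead's `tail_succ_ge_rootGate_mul` drops the first term; `tail_contract_root` is the case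
  `C₀ = 0`).  Hence the tail is AFFINE and NON-DECREASING in the first chain gate, and
* `Quant.BlockComb.tail_ge_of_raise_rootGate` — FAR may be proved AFTER RAISING the first chain gate from `q 0 > 0` to any `t ≥ q 0` with
  the target multiplied by `t/q 0`: LEAD-NOTES-G13 N24 (1)'s contraction principle for EVERY block-comb (no root-mass hypothesis — the
  root crossing term only helps).  Normal form: in a minimal counterexample to the block-comb row the least reliable live root blob is
  TIED, or the first chain gate is sure (then contract a level).
* `Quant.BlockComb.prefixProd_le_update_rootGate` — raising the first gate raises every marginal.
* `Quant.BlockComb.tail_congr_of_live` — the tail depends on the gates of LIVE blobs only (`tail_update_dead` iterated).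
* `Quant.BlockComb.mass_eq_of_rootLive`, `Quant.BlockComb.tail_ge_of_rootStar` — **the block-star row at the root of any chain**: if every
  live blob is at level `0`, `x ≤` every live gate and `2j < Σ a·g`, then `x ≤ TAIL[D, q]` for every chain `q` (the count never sees the
  chain; dead gates are reset to `1` and `tail_one_ge_rootGate_of_mean` is read with chain gate `x` and no level-`1` blob).
-/

namespace Summit.CriticalPhenomena.PercolationContinuityZ3.Theorems

namespace Quant

namespace BlockComb

open Finset

variable {κ : Type*} [Fintype κ] [DecidableEq κ]

/-- product-Bernoulli weight of the set `S` of open blob gates -/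
local notation3 "wt[" g ", " S "]" => ∏ k, (if k ∈ (S : Finset κ) then (g : κ → ℝ) k else 1 - (g : κ → ℝ) k)

/-- the same weight with the gate of `s` removed -/
local notation3 "wt'[" g ", " s ", " S "]" =>
  ∏ k ∈ (Finset.univ : Finset κ).erase s, (if k ∈ (S : Finset κ) then (g : κ → ℝ) k else 1 - (g : κ → ℝ) k)

/-- probability that the chain `q` of length `D` is open exactly to depth `i` -/
local notation3 "pd[" D ", " q ", " i "]" =>
  (∏ i' ∈ Finset.range (i : ℕ), (q : ℕ → ℝ) i') * (if (i : ℕ) < (D : ℕ) then 1 - (q : ℕ → ℝ) i else 1)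

/-- mass counted at depth `i` in blob configuration `S` -/
local notation3 "mass[" lv ", " a ", " i ", " S "]" =>
  ∑ k ∈ (S : Finset κ).filter (fun k => (lv : κ → ℕ) k ≤ (i : ℕ)), ((a : κ → ℕ) k : ℕ)

/-- the tail `P(N ≥ j+1)` of the block-comb count, as an explicit finite sum -/
local notation3 "TAIL[" D ", " q ", " lv ", " a ", " g ", " j "]" =>
  ∑ i ∈ Finset.range ((D : ℕ) + 1), pd[D, q, i] *
    ∑ S : Finset κ, wt[g, S] * (if (j : ℕ) + 1 ≤ mass[lv, a, i, S] then (1 : ℝ) else 0)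

/-! ### 1. The root split as an identity; raising the first chain gate -/

/-- **Root split (identity).**  `TAIL[D+1, q] = (1 − q 0)·C₀ + q 0·TAIL[D, q ∘ succ, lv − 1]` where `C₀ = Σ_S wt S·𝟙[root mass of S ≥ j+1]`
is the probability that the root blobs alone cross (cf. `tail_succ_ge_rootGate_mul`, which drops the first term). [this work] -/
theorem tail_succ_eq_rootSplit (D : ℕ) (q : ℕ → ℝ) (lv : κ → ℕ) (a : κ → ℕ) (g : κ → ℝ) (j : ℕ) :
    TAIL[D + 1, q, lv, a, g, j] =
      (1 - q 0) * ∑ S : Finset κ, wt[g, S] * (if j + 1 ≤ mass[lv, a, 0, S] then (1 : ℝ) else 0) +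
        q 0 * TAIL[D, (fun i => q (i + 1)), (fun k => lv k - 1), a, g, j] := by
  rw [Finset.sum_range_succ']
  have hpd0 : pd[D + 1, q, 0] = 1 - q 0 := by
    show (∏ i' ∈ Finset.range 0, q i') * (if 0 < D + 1 then 1 - q 0 else 1) = 1 - q 0
    rw [Finset.prod_range_zero, one_mul, if_pos (Nat.succ_pos D)]
  have hrest : ∑ i ∈ Finset.range (D + 1), pd[D + 1, q, i + 1] *
      ∑ S : Finset κ, wt[g, S] * (if j + 1 ≤ mass[lv, a, i + 1, S] then (1 : ℝ) else 0) =
        q 0 * TAIL[D, (fun i => q (i + 1)), (fun k => lv k - 1), a, g, j] := by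
    rw [Finset.mul_sum]
    refine Finset.sum_congr rfl fun i _ => ?_
    have hpd : pd[D + 1, q, i + 1] = q 0 * pd[D, (fun i => q (i + 1)), i] := by
      show (∏ i' ∈ Finset.range (i + 1), q i') * (if i + 1 < D + 1 then 1 - q (i + 1) else 1) =
        q 0 * ((∏ i' ∈ Finset.range i, q (i' + 1)) * (if i < D then 1 - q (i + 1) else 1))
      rw [Finset.prod_range_succ']
      by_cases hi' : i < D
      · rw [if_pos hi', if_pos (by omega)]; ring
      · rw [if_neg hi', if_neg (by omega)]; ring
    have hmass : ∀ S : Finset κ, mass[lv, a, i + 1, S] = mass[(fun k => lv k - 1), a, i, S] := by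
      intro S
      refine Finset.sum_congr ?_ fun _ _ => rfl
      ext k
      simp only [Finset.mem_filter]
      constructor
      · rintro ⟨hk, hle⟩; exact ⟨hk, by omega⟩
      · rintro ⟨hk, hle⟩; exact ⟨hk, by omega⟩
    rw [hpd, mul_assoc]
    congr 1
    congr 1
    exact Finset.sum_congr rfl fun S _ => by rw [hmass S]
  rw [hrest, hpd0, add_comm]

/-- **Raising the first chain gate.**  If `0 < q 0 ≤ t ≤ 1` and the instance with first gate `t` satisfies FAR with the scaled target
`x·t/q 0`, then the original satisfies FAR with target `x`: by `tail_succ_eq_rootSplit` the tail is `(1 − q 0)·C₀ + q 0·T₁` with `C₀ ≥ 0`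
and `C₀, T₁` independent of `q 0`.  (LEAD-NOTES-G13 N24 (1) without the root-mass hypothesis; `t ≤ 1` is not even needed for the
inequality, only for the raised instance to be a block-comb.) [this work] -/
theorem tail_ge_of_raise_rootGate (D : ℕ) (q : ℕ → ℝ) (lv : κ → ℕ) (a : κ → ℕ)
    (g : κ → ℝ) (hg : ∀ k, 0 ≤ g k ∧ g k ≤ 1) (j : ℕ) (t : ℝ) (hq0 : 0 < q 0) (hqt : q 0 ≤ t) (x : ℝ)
    (h : x * t / q 0 ≤ TAIL[D + 1, Function.update q 0 t, lv, a, g, j]) :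
    x ≤ TAIL[D + 1, q, lv, a, g, j] := by
  set C0 : ℝ := ∑ S : Finset κ, wt[g, S] * (if j + 1 ≤ mass[lv, a, 0, S] then (1 : ℝ) else 0) with hC0
  set T1 : ℝ := TAIL[D, (fun i => q (i + 1)), (fun k => lv k - 1), a, g, j] with hT1
  have hC0nn : 0 ≤ C0 := Finset.sum_nonneg fun S _ => mul_nonneg (wt_nonneg g hg S) (by split_ifs <;> norm_num)
  have hsucc : (fun i => Function.update q 0 t (i + 1)) = (fun i => q (i + 1)) := by
    funext i; exact Function.update_of_ne (Nat.succ_ne_zero i) t q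
  have hupd : TAIL[D + 1, Function.update q 0 t, lv, a, g, j] = (1 - t) * C0 + t * T1 := by
    rw [tail_succ_eq_rootSplit, Function.update_self, hsucc]
  have horig : TAIL[D + 1, q, lv, a, g, j] = (1 - q 0) * C0 + q 0 * T1 := by
    rw [tail_succ_eq_rootSplit]
  rw [hupd] at h
  rw [horig]
  have ht0 : 0 < t := lt_of_lt_of_le hq0 hqt
  -- multiply `h` by `q 0 / t ≤ 1`
  have h1 : x ≤ (q 0 / t) * ((1 - t) * C0 + t * T1) := by
    have := mul_le_mul_of_nonneg_left h (div_nonneg hq0.le ht0.le)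
    have heq : (q 0 / t) * (x * t / q 0) = x := by field_simp
    rw [heq] at this
    exact this
  have hqt' : q 0 / t * t = q 0 := div_mul_cancel₀ (q 0) (ne_of_gt ht0)
  have h2 : (q 0 / t) * ((1 - t) * C0 + t * T1) = (q 0 / t - q 0) * C0 + q 0 * T1 := by
    have h2' : (q 0 / t) * ((1 - t) * C0 + t * T1) = (q 0 / t - q 0 / t * t) * C0 + (q 0 / t * t) * T1 := by ring
    rw [h2', hqt']
  have h3 : q 0 / t - q 0 ≤ 1 - q 0 := by
    have : q 0 / t ≤ 1 := by rw [div_le_one ht0]; exact hqt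
    linarith
  rw [h2] at h1
  nlinarith [mul_le_mul_of_nonneg_right h3 hC0nn]

omit [Fintype κ] [DecidableEq κ] in
/-- Raising the first chain gate does not decrease any prefix product. [folklore] -/
theorem prefixProd_le_update_rootGate (q : ℕ → ℝ) (hq : ∀ i, 0 ≤ q i ∧ q i ≤ 1) (t : ℝ) (hqt : q 0 ≤ t) (n : ℕ) :
    ∏ i ∈ Finset.range n, q i ≤ ∏ i ∈ Finset.range n, Function.update q 0 t i := by
  cases n with
  | zero => simp
  | succ n =>
    rw [prefixProd_succ, prefixProd_update_succ]
    exact mul_le_mul_of_nonneg_right hqt (Finset.prod_nonneg fun i _ => (hq (i + 1)).1)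

/-! ### 2. Gates of dead blobs; the block-star row at the root -/

/-- **The tail depends on the gates of live blobs only.** [folklore] -/
theorem tail_congr_of_live (D : ℕ) (q : ℕ → ℝ) (lv : κ → ℕ) (a : κ → ℕ) (j : ℕ) :
    ∀ (n : ℕ) (g g' : κ → ℝ), (Finset.univ.filter (fun k => g k ≠ g' k)).card ≤ n →
      (∀ k, 0 < a k → g k = g' k) → TAIL[D, q, lv, a, g, j] = TAIL[D, q, lv, a, g', j] := by
  intro n
  induction n with
  | zero =>
    intro g g' hn _
    have hgg : g = g' := by
      funext k
      by_contra hne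
      have hmem : k ∈ Finset.univ.filter (fun k => g k ≠ g' k) := Finset.mem_filter.2 ⟨Finset.mem_univ _, hne⟩
      have := Finset.card_pos.2 ⟨k, hmem⟩
      omega
    rw [hgg]
  | succ n ih =>
    intro g g' hn hlive
    by_cases hall : ∀ k, g k = g' k
    · rw [show g = g' from funext hall]
    · push Not at hall
      obtain ⟨s, hs⟩ := hall
      have has : a s = 0 := by
        by_contra hne
        exact hs (hlive s (Nat.pos_of_ne_zero hne))
      -- reset the gate of the dead blob `s` to `g' s`
      rw [← tail_update_dead D q lv a g j s (g' s) has]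
      refine ih (Function.update g s (g' s)) g' ?_ ?_
      · have hsub : Finset.univ.filter (fun k => Function.update g s (g' s) k ≠ g' k) ⊆
            (Finset.univ.filter (fun k => g k ≠ g' k)).erase s := by
          intro k hk
          have hk' := (Finset.mem_filter.1 hk).2
          have hks : k ≠ s := fun h => by rw [h, Function.update_self] at hk'; exact hk' rfl
          rw [Function.update_of_ne hks] at hk'
          exact Finset.mem_erase.2 ⟨hks, Finset.mem_filter.2 ⟨Finset.mem_univ _, hk'⟩⟩
        have hsmem : s ∈ Finset.univ.filter (fun k => g k ≠ g' k) := Finset.mem_filter.2 ⟨Finset.mem_univ _, hs⟩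
        have h1 := Finset.card_le_card hsub
        rw [Finset.card_erase_of_mem hsmem] at h1
        have hpos : 0 < (Finset.univ.filter (fun k => g k ≠ g' k)).card := Finset.card_pos.2 ⟨s, hsmem⟩
        omega
      · intro k hk
        by_cases hks : k = s
        · rw [hks, Function.update_self]
        · rw [Function.update_of_ne hks]; exact hlive k hk

omit [Fintype κ] [DecidableEq κ] in
/-- If every live blob sits at the root, the mass counted at any depth is the total open mass. [folklore] -/
theorem mass_eq_of_rootLive (lv lv' : κ → ℕ) (a : κ → ℕ) (hroot : ∀ k, 0 < a k → lv k = 0) (hroot' : ∀ k, 0 < a k → lv' k = 0)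
    (i i' : ℕ) (S : Finset κ) : mass[lv, a, i, S] = mass[lv', a, i', S] := by
  have h1 : mass[lv, a, i, S] = ∑ k ∈ S, a k := by
    rw [Finset.sum_filter]
    refine Finset.sum_congr rfl fun k _ => ?_
    by_cases hk : lv k ≤ i
    · rw [if_pos hk]
    · rw [if_neg hk]
      by_contra hne
      have := hroot k (Nat.pos_of_ne_zero (Ne.symm hne))
      omega
  have h2 : mass[lv', a, i', S] = ∑ k ∈ S, a k := by
    rw [Finset.sum_filter]
    refine Finset.sum_congr rfl fun k _ => ?_
    by_cases hk : lv' k ≤ i'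
    · rw [if_pos hk]
    · rw [if_neg hk]
      by_contra hne
      have := hroot' k (Nat.pos_of_ne_zero (Ne.symm hne))
      omega
  rw [h1, h2]

/-- **The block-star row at the root, any depth.**  If every live blob is at level `0`, `x ≤ g k` for every live blob and `2j < Σ_k a k·g k`,
then `x ≤ TAIL[D, q, lv, a, g, j]` (for any chain: the count does not see it).  Proof: the gates of dead blobs are reset to `1`
(`tail_congr_of_live`), every inner configuration sum is the one of `tail_one_ge_rootGate_of_mean` with chain gate `x` and no level-`1`
blob, and `Σ_i pd i = 1`. [this work] -/
theorem tail_ge_of_rootStar (D : ℕ) (q : ℕ → ℝ) (hq : ∀ i, 0 ≤ q i ∧ q i ≤ 1) (lv : κ → ℕ) (a : κ → ℕ)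
    (g : κ → ℝ) (hg : ∀ k, 0 ≤ g k ∧ g k ≤ 1) (j : ℕ) (x : ℝ) (hroot : ∀ k, 0 < a k → lv k = 0)
    (hx : ∀ k, 0 < a k → x ≤ g k) (hmean : (2 * j : ℝ) < ∑ k, (a k : ℝ) * g k) :
    x ≤ TAIL[D, q, lv, a, g, j] := by
  rcases le_or_gt x 0 with hx0 | hx0
  · exact hx0.trans (tail_nonneg D q hq lv a g hg j)
  -- a live blob exists, so `x ≤ 1`
  have hlive : ∃ k, 0 < a k := by
    by_contra hnone
    push Not at hnone
    have : ∑ k, (a k : ℝ) * g k = 0 := Finset.sum_eq_zero fun k _ => by rw [Nat.le_zero.1 (hnone k)]; simp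
    rw [this] at hmean
    have : (0 : ℝ) ≤ 2 * j := by positivity
    linarith
  obtain ⟨k₀, hk₀⟩ := hlive
  have hx1 : x ≤ 1 := (hx k₀ hk₀).trans (hg k₀).2
  -- reset dead gates to `1`
  set g' : κ → ℝ := fun k => if 0 < a k then g k else 1 with hg'
  have hg'01 : ∀ k, 0 ≤ g' k ∧ g' k ≤ 1 := by
    intro k; by_cases hk : 0 < a k
    · simp only [hg', if_pos hk]; exact hg k
    · simp only [hg', if_neg hk]; norm_num
  have hgg' : ∀ k, 0 < a k → g k = g' k := fun k hk => by simp only [hg', if_pos hk]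
  have hx' : ∀ k, x ≤ g' k := by
    intro k; by_cases hk : 0 < a k
    · rw [← hgg' k hk]; exact hx k hk
    · simp only [hg', if_neg hk]; exact hx1
  rw [tail_congr_of_live D q lv a j _ g g' le_rfl hgg']
  -- the block-star row with chain gate `x` and every blob at the root
  have hmean' : (2 * j : ℝ) < ∑ k ∈ Finset.univ.filter (fun k => (fun _ : κ => (0 : ℕ)) k = 0), (a k : ℝ) * g' k +
      x * ∑ k ∈ Finset.univ.filter (fun k => (fun _ : κ => (0 : ℕ)) k ≠ 0), (a k : ℝ) := by
    have h1 : Finset.univ.filter (fun k => (fun _ : κ => (0 : ℕ)) k = 0) = Finset.univ :=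
      Finset.filter_true_of_mem fun k _ => rfl
    have h2 : Finset.univ.filter (fun k => (fun _ : κ => (0 : ℕ)) k ≠ 0) = ∅ := by
      ext k; simp
    rw [h1, h2, Finset.sum_empty, mul_zero, add_zero]
    have h3 : ∑ k, (a k : ℝ) * g' k = ∑ k, (a k : ℝ) * g k := by
      refine Finset.sum_congr rfl fun k _ => ?_
      by_cases hk : 0 < a k
      · rw [hgg' k hk]
      · have : a k = 0 := by omega
        rw [this]; simp
    rw [h3]; exact hmean
  have hstar := tail_one_ge_rootGate_of_mean (fun _ => x) ⟨hx0.le, hx1⟩ (fun _ => (0 : ℕ)) (fun _ => Nat.zero_le 1) a g' hg'01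
    (fun k _ => hx' k) (fun k hk => absurd rfl hk) j hmean'
  -- every inner configuration sum equals the full-mass crossing probability `C`
  set C : ℝ := ∑ S : Finset κ, wt[g', S] * (if j + 1 ≤ mass[(fun _ : κ => (0 : ℕ)), a, 0, S] then (1 : ℝ) else 0) with hC
  have hinner : ∀ i, ∑ S : Finset κ, wt[g', S] * (if j + 1 ≤ mass[lv, a, i, S] then (1 : ℝ) else 0) = C := by
    intro i
    refine Finset.sum_congr rfl fun S _ => ?_
    rw [mass_eq_of_rootLive lv (fun _ => 0) a hroot (fun _ _ => rfl) i 0 S]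
  have hinner' : ∀ i, ∑ S : Finset κ, wt[g', S] * (if j + 1 ≤ mass[(fun _ : κ => (0 : ℕ)), a, i, S] then (1 : ℝ) else 0) = C := by
    intro i
    refine Finset.sum_congr rfl fun S _ => ?_
    rw [mass_eq_of_rootLive (fun _ => 0) (fun _ => 0) a (fun _ _ => rfl) (fun _ _ => rfl) i 0 S]
  -- the star's tail is `C`
  have hstarC : TAIL[1, (fun _ => x), (fun _ : κ => (0 : ℕ)), a, g', j] = C := by
    rw [Finset.sum_range_succ, Finset.sum_range_one, hinner' 0, hinner' 1]
    have hpd0 : pd[1, (fun _ => x), 0] = 1 - x := by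
      show (∏ i' ∈ Finset.range 0, (fun _ => x) i') * (if 0 < 1 then 1 - (fun _ : ℕ => x) 0 else 1) = 1 - x
      simp
    have hpd1 : pd[1, (fun _ => x), 1] = x := by
      show (∏ i' ∈ Finset.range 1, (fun _ : ℕ => x) i') * (if 1 < 1 then 1 - (fun _ : ℕ => x) 1 else 1) = x
      simp
    rw [hpd0, hpd1]; ring
  -- our tail is `C` as well
  have hours : TAIL[D, q, lv, a, g', j] = C := by
    calc TAIL[D, q, lv, a, g', j] = ∑ i ∈ Finset.range (D + 1), pd[D, q, i] * C :=
          Finset.sum_congr rfl fun i _ => by rw [hinner i]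
      _ = (∑ i ∈ Finset.range (D + 1), pd[D, q, i]) * C := by rw [Finset.sum_mul]
      _ = C := by
          have h := pd_tail_sum q D 0 (Nat.zero_le D)
          rw [Finset.filter_true_of_mem (fun i _ => Nat.zero_le i), Finset.prod_range_zero] at h
          rw [h, one_mul]
  rw [hours, ← hstarC]
  exact hstar

end BlockComb

end Quant

end Summit.CriticalPhenomena.PercolationContinuityZ3.Theorems
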